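import Literature.NumberTheory.EllipticCurves.Kato2004.IwasawaCohomologyNumberFieldIsogeny
import Literature.NumberTheory.EllipticCurves.Kato2004.EllipticZetaReciprocity
import Literature.NumberTheory.EllipticCurves.IsogenyDualProofs
import HarnessLib

set_option autoImplicit false

/-!
# Kato 2004 (Astérisque 295) §15.5–15.9 along a `K`-isogeny: the Prop. 15.9 / (15.9.1) package
# `CM.EllipticZetaBody` of the twisted elliptic units is TRANSPORTED from `T_pE` to `T_pE′` for an isogeny
# `E → E′` over the number field `K` whose degree is prime to the level `p·f`

Topic `NumberTheory/EllipticCurves`, sub-directory `Kato2004` (namespace = path, sub-namespace `CM` as in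
`EllipticZetaReciprocity.lean`).  Cell `bsd-cm`, seat `bsd-cm-k-ty1` g29 (literature-prover; hands on the
elliptic-unit column (C3) of row K2C-6 of crux `stmt-BirchSwinnertonDyer-19945`, K7r): the `K`-side twin of
`Kato2004/EulerSystemIsogenyTransportZeta.lean` (`ZetaBody.isogeny_transport`, the `ℚ`-side, cyclotomic levels)
for the `K`-side matrix `CM.EllipticZetaBody` (ray-class layers of `K(p^∞𝔣)/K`).  USE: the named fact
`CM.prop159_ellipticUnits_expStar_values` is stated for curves `A/ℚ` with complex multiplication by the MAXIMAL
order (`A.j ∈ maximalCMJInvariants`); a member of the isogeny class with CM by a non-maximal order (e.g.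
`j = 16581375`, the order `ℤ[√−7]` of conductor `2`, `2`-isogenous to `j = −3375`) receives the package along the
isogeny — Kato states (15.9)/(15.6.3) for the lattice `T` of the CM-pair and §8.1 (8.1.3)/Ex. 13.3 record that
the Euler-system classes are functorial in the lattice; this file is that bookkeeping on the `K`-side.
HONEST FRAMING: folklore functoriality, PROVED; no named fact is added or discharged; nothing about any zeta
value, main conjecture or BSD is asserted; no summit statement is touched.

## Mathematical content (all proved)

Let `α : E → E′`, `β : E′ → E` be isogenies of elliptic curves over a field `K` with `β ∘ α = [d]` on `E(K̄)`.

* §1 **Torsion layers agree in level prime to `d`.**  If `gcd(d, m) = 1` then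
  `Gal(K̄/K(E[m])) = Gal(K̄/K(E′[m]))` (`torsionLayer_eq_of_isogeny`): `α` restricts to a `Γ_K`-equivariant
  bijection `E[m] → E′[m]` — if `σ` fixes `E′[m]` and `P ∈ E[m]` then `α(σP − P) = 0`, so `d(σP − P) = 0 = m(σP − P)`
  and Bézout gives `σP = P`; if `σ` fixes `E[m]` and `Q = αP ∈ E′[m]` (`α` is onto, `Isogeny.surjective`) then
  `dm·P = β(α(mP)) = 0`, and with `ad + bm = 1` the point `P′ = ad·P` lies in `E[m]` and `αP′ = Q`, so `σQ = Q`.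
  Hence the ray-class layers of the towers `K(E[p^n f])`, `K(E′[p^n f])` coincide when `gcd(d, pf) = 1`
  (`isRayClassLayer_iff_of_isogeny`).  (For `d` NOT prime to the level the towers differ in general — a
  `14`-isogeny kills `E[7]` — so the hypothesis is sharp for the use.)
* §2 The push-forward `α_* : H¹(U, T_pE) → H¹(U, T_pE′)` of the tree (`isogenyLayerMapK`,
  `IwasawaCohomologyNumberFieldIsogeny.lean`) preserves local triviality at `p` and commutes with the trace maps
  `CM.layerCores` (restriction / corestriction commute with maps of coefficients, Serre I §2.4).
* §3 **`EllipticZetaBody.isogeny_transport`.**  If `(Ω, 𝔏, w, y)` satisfy `EllipticZetaBody K E p ψ f ι Ω 𝔏 𝔞 w y`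
  and `gcd(d, pf) = 1` (so `d ∈ ℤ_p^×`), then the pushed classes `w′_U := α_*(w_U)` and the pulled datum
  `𝔏′_U := 𝔏_U ∘ (d⁻¹·β_*)` (a `ℤ_p`-scalar — no `ℚ_p`-structure is needed) with the SAME `(ψ, f, ι, Ω, 𝔞, y)` satisfy
  `EllipticZetaBody K E′ p ψ f ι Ω 𝔏′ 𝔞 w′ y`: (Z1) norm-compatibility (`α_*` commutes with `Cor`), (Z2) integrality
  (`isogenyLayerMapK_mem_integralH1K`), (Z3a) `Γ_K`-equivariance of `𝔏′` on the normal layers `Gal(K̄/K(E′[p^n f]))`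
  (= those of `E` by §1; `β_*` commutes with conjugation), (Z3b) locality at `p`, (Z4) `𝔏′(α_* w) = d⁻¹·𝔏(β_*α_* w) =
  d⁻¹·d·𝔏(w) = 1 ⊗ y`, (Z5) the value law is a statement about `y`, `ψ`, `Ω` only — unchanged.  Quantifier shape of
  the named fact: `exists_ellipticZetaBody_of_isogeny` (ONE datum `𝔏′` at `E′` from ONE datum `𝔏` at `E`, serving every
  twist `𝔞`).

## References

* K. Kato, Astérisque 295 (2004): §8.1 (8.1.3) (p. 180) and Ex. 13.3 (p. 225) (functoriality of the classes in the
  lattice), §15.5 (p. 253), §15.6 (15.6.3) (pp. 253–254), Prop. 15.9 and (15.9.1) (pp. 258–259). [Kato2004Asterisque]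
* J.-P. Serre, *Galois Cohomology* (1997), I §2.2, §2.4 (functoriality of `H¹`; compatibility with `res`/`cor`).
  [SerreGaloisCohomology1997]
* J. H. Silverman, *AEC* (2009), Thm. II.2.3 (morphisms of curves are onto), III.4 (isogenies, `E[m]`), Thm. III.6.1 (a)
  (`φ̂ ∘ φ = [m]`), III.7.4 (`T_ℓ φ`), III.§7 (the fields `K(E[m])`). [SilvermanAEC2009]
* Tree: `Kato2004/IwasawaCohomologyNumberFieldIsogeny.lean` (`isogenyLayerMapK` and its compatibilities),
  `Kato2004/EllipticZetaReciprocity.lean` (`torsionLayer`, `IsRayClassLayer`, `layerCores`, `IsLocallyTrivialAt`,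
  `integralH1K`, `EllipticZetaBody`, `prop159_ellipticUnits_expStar_values`), `IsogenyDualProofs.lean`
  (`Isogeny.surjective`), `Kato2004/EulerSystemIsogenyTransportZeta.lean` (the `ℚ`-side model).
-/

noncomputable section

open scoped NumberField TensorProduct
open Field IsDedekindDomain NumberField
open Literature.NumberTheory.GaloisRepresentations
open Literature.NumberTheory.EllipticCurves

namespace Literature.NumberTheory.EllipticCurves.Kato2004.CM

/-! ## §1 The torsion layers `Gal(K̄/K(E[m]))` agree along an isogeny of degree prime to `m` -/

section TorsionLayer

variable {K : Type} [Field K] {E E' : WeierstrassCurve K}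

/-- Membership in the torsion layer: `σ ∈ Gal(K̄/K(E[m]))` iff `σ` fixes every `m`-torsion point of `E(K̄)`.
[cite: SilvermanAEC2009, III §7 (the field `K(E[m])`)] -/
theorem mem_torsionLayer_iff (E : WeierstrassCurve K) (m : ℕ) (σ : absoluteGaloisGroup K) :
    σ ∈ torsionLayer E m ↔ ∀ P : E.geomPoints, (m : ℤ) • P = 0 → σ • P = P := by
  rw [torsionLayer, MonoidHom.mem_ker]
  constructor
  · intro hσ P hP
    have hPmem : P ∈ WeierstrassCurve.geomTorsion E (m : ℤ) := (Submodule.mem_torsionBy_iff (m : ℤ) P).mpr hP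
    have hfix : ∀ Q : WeierstrassCurve.geomTorsion E (m : ℤ), σ • Q = Q := fun Q ↦ by
      have h1 := DFunLike.congr_fun (congrArg Multiplicative.toAdd hσ) Q
      rwa [WeierstrassCurve.galoisRepTorsion_apply] at h1
    have h2 := congrArg (fun Q : WeierstrassCurve.geomTorsion E (m : ℤ) ↦ (Q : E.geomPoints)) (hfix ⟨P, hPmem⟩)
    rwa [AddSubgroup.torsionBy.coe_smul] at h2
  · intro h
    refine Multiplicative.toAdd.injective (AddEquiv.ext fun Q ↦ ?_)
    rw [WeierstrassCurve.galoisRepTorsion_apply]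
    exact Subtype.ext (by
      rw [AddSubgroup.torsionBy.coe_smul]
      exact h Q ((Submodule.mem_torsionBy_iff (m : ℤ) (Q : E.geomPoints)).mp Q.2))

/-- **`Gal(K̄/K(E′[m])) ≤ Gal(K̄/K(E[m]))` along `β ∘ α = [d]`, `gcd(d, m) = 1`**: if `σ` fixes `E′[m]` and `P ∈ E[m]`
then `α(σP − P) = σ(αP) − αP = 0`, hence `d·(σP − P) = β(α(σP − P)) = 0` and `m·(σP − P) = 0`; Bézout.
(No surjectivity and no ellipticity needed in this direction.) [cite: SilvermanAEC2009, III.4 and III §7] -/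
theorem torsionLayer_le_torsionLayer_of_isogeny (α : WeierstrassCurve.Isogeny E E')
    (β : WeierstrassCurve.Isogeny E' E) {d : ℤ} (hβα : ∀ P, β (α P) = d • P) {m : ℕ}
    (hdm : IsCoprime d (m : ℤ)) : torsionLayer E' m ≤ torsionLayer E m := by
  intro σ hσ
  rw [mem_torsionLayer_iff] at hσ ⊢
  intro P hP
  have h1 : σ • α P = α P := hσ (α P) (by rw [← map_zsmul, hP, map_zero])
  have h2 : α (σ • P - P) = 0 := by rw [map_sub, α.map_smul, h1, sub_self]
  have h3 : d • (σ • P - P) = 0 := by rw [← hβα, h2, map_zero]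
  have h4 : (m : ℤ) • (σ • P - P) = 0 := by rw [smul_sub, smul_comm, hP, smul_zero, sub_self]
  obtain ⟨a, b, hab⟩ := hdm
  rw [← sub_eq_zero, ← one_smul ℤ (σ • P - P), ← hab, add_smul, mul_smul, mul_smul, h3, h4, smul_zero,
    smul_zero, add_zero]

/-- **`Gal(K̄/K(E[m])) ≤ Gal(K̄/K(E′[m]))` along `β ∘ α = [d]`, `gcd(d, m) = 1`, for ELLIPTIC `E`, `E′`** (isogenies are
onto on `K̄`-points, `Isogeny.surjective`): for `Q = αP ∈ E′[m]`, `dm·P = β(α(mP)) = β(mQ) = 0`; with `ad + bm = 1`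
the point `P′ = ad·P` is `m`-torsion and `αP′ = αP − b·(m·αP) = Q`, so `σQ = α(σP′) = αP′ = Q`.
[cite: SilvermanAEC2009, Thm. II.2.3, III.4 and III §7] -/
theorem torsionLayer_le_torsionLayer_of_isogeny' [E.IsElliptic] [E'.IsElliptic] (α : WeierstrassCurve.Isogeny E E')
    (β : WeierstrassCurve.Isogeny E' E) {d : ℤ} (hβα : ∀ P, β (α P) = d • P) {m : ℕ}
    (hdm : IsCoprime d (m : ℤ)) : torsionLayer E m ≤ torsionLayer E' m := by
  intro σ hσ
  rw [mem_torsionLayer_iff] at hσ ⊢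
  intro Q hQ
  obtain ⟨P, rfl⟩ := α.surjective Q
  obtain ⟨a, b, hab⟩ := hdm
  have h1 : (d * m) • P = 0 := by
    rw [mul_comm, mul_smul, ← hβα, ← map_zsmul, hQ, map_zero]
  have h2 : (m : ℤ) • ((a * d) • P) = 0 := by
    rw [smul_smul, show (m : ℤ) * (a * d) = a * (d * m) by ring, mul_smul, h1, smul_zero]
  have h3 : α ((a * d) • P) = α P := by
    conv_rhs => rw [← one_smul ℤ P, ← hab, add_smul, map_add, map_zsmul α (b * ↑m) P, ← smul_smul b (↑m) (α P), hQ,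
      smul_zero, add_zero]
  rw [← h3, ← α.map_smul, hσ _ h2]

/-- **The torsion layers agree**: `Gal(K̄/K(E[m])) = Gal(K̄/K(E′[m]))` for elliptic `E`, `E′` linked by isogenies `α`, `β` with
`β ∘ α = [d]` and `gcd(d, m) = 1` (`α|: E[m] ≅ E′[m]` as `Γ_K`-modules). [cite: SilvermanAEC2009, III.4 and III §7] -/
theorem torsionLayer_eq_of_isogeny [E.IsElliptic] [E'.IsElliptic] (α : WeierstrassCurve.Isogeny E E')
    (β : WeierstrassCurve.Isogeny E' E) {d : ℤ} (hβα : ∀ P, β (α P) = d • P) {m : ℕ}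
    (hdm : IsCoprime d (m : ℤ)) : torsionLayer E' m = torsionLayer E m :=
  le_antisymm (torsionLayer_le_torsionLayer_of_isogeny α β hβα hdm)
    (torsionLayer_le_torsionLayer_of_isogeny' α β hβα hdm)

/-- `gcd(d, p·f) = 1 ⟹ gcd(d, p^n·f) = 1`. [folklore] -/
private theorem isCoprime_pow_mul_of_isCoprime_mul {d : ℤ} {p f : ℕ} (hd : IsCoprime d ((p * f : ℕ) : ℤ)) (n : ℕ) :
    IsCoprime d ((p ^ n * f : ℕ) : ℤ) := by
  push_cast at hd ⊢
  exact (IsCoprime.pow_right (hd.of_mul_right_left)).mul_right hd.of_mul_right_right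

/-- **The ray-class layers of the towers `K(E[p^∞ f])` and `K(E′[p^∞ f])` coincide** for elliptic `E`, `E′` linked by
`α`, `β` with `β ∘ α = [d]`, `gcd(d, p·f) = 1`: `IsRayClassLayer E′ p f U ↔ IsRayClassLayer E p f U` for every `U ≤ Γ_K`.
[cite: Kato2004Asterisque, §15.1 (p. 250) and Prop. 15.9 (p. 258)] [cite: SilvermanAEC2009, III §7] -/
theorem isRayClassLayer_iff_of_isogeny [E.IsElliptic] [E'.IsElliptic] (α : WeierstrassCurve.Isogeny E E')
    (β : WeierstrassCurve.Isogeny E' E) {d : ℤ} (hβα : ∀ P, β (α P) = d • P) {p f : ℕ}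
    (hd : IsCoprime d ((p * f : ℕ) : ℤ)) (U : Subgroup (absoluteGaloisGroup K)) :
    IsRayClassLayer E' p f U ↔ IsRayClassLayer E p f U := by
  have key : ∀ n : ℕ, torsionLayer E' (p ^ n * f) = torsionLayer E (p ^ n * f) := fun n ↦
    torsionLayer_eq_of_isogeny α β hβα (isCoprime_pow_mul_of_isCoprime_mul hd n)
  simp only [IsRayClassLayer, key]

end TorsionLayer

/-! ## §2 The push-forward `α_*` preserves locality at `p` and commutes with the ray-class trace maps -/

section PushForward

variable {K : Type} [Field K] {E E' : WeierstrassCurve K} (p : ℕ) [Fact p.Prime]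
  [ContinuousSMul ℤ_[p] (E.tateModule p)] [ContinuousSMul ℤ_[p] (E'.tateModule p)]

/-- Local triviality at `p` is preserved by scalars. [cite: Kato2004Asterisque, §9.4 (p. 188)] -/
theorem IsLocallyTrivialAt.smul {A : Type} [CommRing A] [TopologicalSpace A] {M : Type} [AddCommGroup M] [Module A M]
    [TopologicalSpace M] [IsTopologicalAddGroup M] [ContinuousSMul A M] {T : GaloisRep K A M} {q : ℕ}
    {U : Subgroup (absoluteGaloisGroup K)} {x : H1 T U} (hx : IsLocallyTrivialAt T q U x) (c : A) :
    IsLocallyTrivialAt T q U (c • x) := by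
  intro v hv 𝔓 h𝔓
  rw [map_smul, hx v hv 𝔓 h𝔓, smul_zero]

/-- **`α_*` preserves local triviality at `p`** (it commutes with the restriction to every decomposition group).
[cite: SerreGaloisCohomology1997, I §2.4] [cite: Kato2004Asterisque, §9.4 (p. 188)] -/
theorem isLocallyTrivialAt_isogenyLayerMapK (α : WeierstrassCurve.Isogeny E E') (U : Subgroup (absoluteGaloisGroup K))
    {x : H1 (tateRepK E p) U} (hx : IsLocallyTrivialAt (tateRepK E p) p U x) :
    IsLocallyTrivialAt (tateRepK E' p) p U (isogenyLayerMapK p α U x) := by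
  intro v hv 𝔓 h𝔓
  rw [← isogenyLayerMapK_resLe, hx v hv 𝔓 h𝔓, map_zero]

variable [NumberField K]

/-- `CM.layerCores` is the relative corestriction `coresLe` for ANY finiteness structure on the quotient.
[cite: Kato2004Asterisque, §15.6 (p. 253)] -/
theorem layerCores_eq_coresLe {A : Type} [CommRing A] [TopologicalSpace A] {M : Type} [AddCommGroup M] [Module A M]
    [TopologicalSpace M] [IsTopologicalAddGroup M] [ContinuousSMul A M] (T : GaloisRep K A M)
    {U U' : Subgroup (absoluteGaloisGroup K)} (h : U ≤ U') (hU : IsOpen (U : Set (absoluteGaloisGroup K)))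
    [inst : Fintype (U' ⧸ U.subgroupOf U')] (c : H1 T U) :
    layerCores T h hU c = coresLe T.toTopRep h hU c := by
  haveI : U.FiniteIndex := finiteIndex_of_isOpen_of_compactSpace _ hU
  obtain rfl : inst = Fintype.ofFinite _ := Subsingleton.elim _ _
  rfl

/-- **`α_*` commutes with the trace maps `Cor_{K′/K″}` of the ray-class tower** (`CM.layerCores`).
[cite: SerreGaloisCohomology1997, I §2.4] [cite: Kato2004Asterisque, §15.5–15.6 (p. 253)] -/
theorem isogenyLayerMapK_layerCores (α : WeierstrassCurve.Isogeny E E') {U U' : Subgroup (absoluteGaloisGroup K)}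
    (h : U ≤ U') (hU : IsOpen (U : Set (absoluteGaloisGroup K))) (c : H1 (tateRepK E p) U) :
    isogenyLayerMapK p α U' (layerCores (tateRepK E p) h hU c) =
      layerCores (tateRepK E' p) h hU (isogenyLayerMapK p α U c) := by
  haveI : U.FiniteIndex := finiteIndex_of_isOpen_of_compactSpace _ hU
  letI : Fintype (U' ⧸ U.subgroupOf U') := Fintype.ofFinite _
  rw [layerCores_eq_coresLe, layerCores_eq_coresLe]
  exact isogenyLayerMapK_coresLe p α h hU c

end PushForward

/-! ## §3 Transport of `EllipticZetaBody` along an isogeny of degree prime to `p·f` -/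

section Transport

variable {K : Type} [Field K] [NumberField K] {E E' : WeierstrassCurve K} [E.IsElliptic] [E'.IsElliptic]
  (p : ℕ) [Fact p.Prime] [ContinuousSMul ℤ_[p] (E.tateModule p)] [ContinuousSMul ℤ_[p] (E'.tateModule p)]

omit [NumberField K] [E.IsElliptic] [E'.IsElliptic] in
/-- `ℤ_p`-scalars pass through `1 ⊗ σ` on `ℚ_p ⊗_ℤ K̄`. [folklore] -/
private theorem map_id_smul (g : AlgebraicClosure K →ₗ[ℤ] AlgebraicClosure K) (c : ℤ_[p])
    (t : ℚ_[p] ⊗[ℤ] AlgebraicClosure K) :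
    TensorProduct.map (LinearMap.id : ℚ_[p] →ₗ[ℤ] ℚ_[p]) g (c • t) =
      c • TensorProduct.map (LinearMap.id : ℚ_[p] →ₗ[ℤ] ℚ_[p]) g t := by
  induction t using TensorProduct.induction_on with
  | zero => rw [smul_zero, map_zero, smul_zero]
  | tmul a b => rw [TensorProduct.smul_tmul', TensorProduct.map_tmul, TensorProduct.map_tmul, TensorProduct.smul_tmul',
      LinearMap.id_apply, LinearMap.id_apply]
  | add x y hx hy => rw [smul_add, map_add, hx, hy, map_add, smul_add]

/-- An integer prime to `p` is a unit of `ℤ_p`. [folklore] -/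
private theorem isUnit_intCast_padicInt_of_isCoprime {d : ℤ} {f : ℕ} (hd : IsCoprime d ((p * f : ℕ) : ℤ)) :
    IsUnit ((d : ℤ_[p])) := by
  have hdp : IsCoprime d (p : ℤ) := by
    push_cast at hd
    exact hd.of_mul_right_left
  have hndvd : ¬ (p : ℤ) ∣ d := by
    intro hdvd
    have hpp : IsCoprime (p : ℤ) (p : ℤ) := hdp.of_isCoprime_of_dvd_left hdvd
    rw [isCoprime_self, Int.isUnit_iff_natAbs_eq, Int.natAbs_natCast] at hpp
    exact (Fact.out : p.Prime).one_lt.ne' hpp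
  rw [PadicInt.isUnit_iff]
  by_contra hne
  exact hndvd (PadicInt.norm_int_lt_one_iff_dvd d |>.mp (lt_of_le_of_ne (PadicInt.norm_le_one _) hne))

/-- **An isogeny of degree prime to `p·f` transports Kato's Prop. 15.9 package (`EllipticZetaBody`) from `T_pE` to
`T_pE′`.**  For isogenies `α : E → E′`, `β : E′ → E` of elliptic curves over the number field `K` with `β ∘ α = [d]`,
`gcd(d, p·f) = 1`, `u ∈ ℤ_p^×` the unit `d`, and data `(Ω, 𝔏, w, y)` with `EllipticZetaBody K E p ψ f ι Ω 𝔏 𝔞 w y`: the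
pushed-forward classes `α_*(w_U)` and the datum `𝔏′_U = 𝔏_U ∘ (u⁻¹ · β_*)`, with the SAME `(ψ, f, ι, Ω, 𝔞, y)`, satisfy
`EllipticZetaBody K E′ p ψ f ι Ω 𝔏′ 𝔞 (α_* w) y` — (Z1) `α_*` commutes with the trace maps, (Z2) preserves
`H¹(O_{K′}[1/p], ·)`, (Z3a) `β_*` commutes with the `Γ_K`-action on the normal layers (which are those of `E` by
`torsionLayer_eq_of_isogeny`), (Z3b) `β_*` preserves locality at `p`, (Z4) `u⁻¹ · 𝔏(β_* α_* w) = u⁻¹ · d · (1 ⊗ y) = 1 ⊗ y`,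
(Z5) concerns `y`, `ψ`, `Ω` only.  (Kato (15.6.3)/(15.9.1) for the lattice of the CM-pair; this moves the package to
a `K`-isogenous lattice, as §8.1 (8.1.3)/Ex. 13.3 do over `ℚ`.)
[cite: Kato2004Asterisque, §8.1 (8.1.3) (p. 180), §15.6 (15.6.3) (pp. 253–254), Prop. 15.9 and (15.9.1) (pp. 258–259)]
[cite: SerreGaloisCohomology1997, I §2.4] [cite: SilvermanAEC2009, Thm. III.6.1 (a) and III.7.4] -/
theorem EllipticZetaBody.isogeny_transport (α : WeierstrassCurve.Isogeny E E') (β : WeierstrassCurve.Isogeny E' E)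
    {d : ℤ} (hβα : ∀ P, β (α P) = d • P) (u : ℤ_[p]ˣ) (hu : (u : ℤ_[p]) = d) {f : ℕ}
    (hdf : IsCoprime d ((p * f : ℕ) : ℤ))
    {ψ : HeckeCharacter K} {ι : AlgebraicClosure K →+* ℂ} {Ω : ℂ}
    {𝔏 : ∀ U : Subgroup (absoluteGaloisGroup K), H1 (tateRepK E p) U →ₗ[ℤ_[p]] ℚ_[p] ⊗[ℤ] AlgebraicClosure K}
    {𝔞 : Ideal (𝓞 K)} {w : ∀ U : Subgroup (absoluteGaloisGroup K), H1 (tateRepK E p) U}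
    {y : Subgroup (absoluteGaloisGroup K) → AlgebraicClosure K}
    (h : EllipticZetaBody K E p ψ f ι Ω 𝔏 𝔞 w y) :
    EllipticZetaBody K E' p ψ f ι Ω
      (fun U ↦ 𝔏 U ∘ₗ (((u⁻¹ : ℤ_[p]ˣ) : ℤ_[p]) • isogenyLayerMapK p β U)) 𝔞
      (fun U ↦ isogenyLayerMapK p α U (w U)) y := by
  have hlay : ∀ U : Subgroup (absoluteGaloisGroup K), IsRayClassLayer E' p f U ↔ IsRayClassLayer E p f U :=
    isRayClassLayer_iff_of_isogeny α β hβα hdf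
  have htor : ∀ n : ℕ, torsionLayer E' (p ^ n * f) = torsionLayer E (p ^ n * f) := fun n ↦
    torsionLayer_eq_of_isogeny α β hβα (isCoprime_pow_mul_of_isCoprime_mul hdf n)
  obtain ⟨h1, h2, h3a, h3b, h4, h5⟩ := h
  -- (Z3a) for `E`, generalised to any subgroup EQUAL to a normal layer of `E` (dependent-type bookkeeping)
  have h3a' : ∀ (U : Subgroup (absoluteGaloisGroup K)) (n : ℕ), U = torsionLayer E (p ^ n * f) →
      ∀ [U.Normal] (σ : absoluteGaloisGroup K) (x : H1 (tateRepK E p) U),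
        𝔏 U (conjMap (tateRepK E p).toTopRep U σ 1 x) =
          TensorProduct.map (LinearMap.id : ℚ_[p] →ₗ[ℤ] ℚ_[p])
            (((MulSemiringAction.toRingHom _ (AlgebraicClosure K) σ : AlgebraicClosure K →+*
                AlgebraicClosure K) : AlgebraicClosure K →+ AlgebraicClosure K).toIntLinearMap)
            (𝔏 U x) := by
    rintro U n rfl _ σ x
    exact h3a n σ x
  refine ⟨?_, ?_, ?_, ?_, ?_, ?_⟩
  · -- (Z1) norm compatibility
    intro U U' hU hU' hle
    have hUE : IsRayClassLayer E p f U := (hlay U).mp hU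
    have hU'E : IsRayClassLayer E p f U' := (hlay U').mp hU'
    change layerCores (tateRepK E' p) hle hU.isOpen (isogenyLayerMapK p α U (w U)) =
      isogenyLayerMapK p α U' (w U')
    rw [← h1 U U' hUE hU'E hle, isogenyLayerMapK_layerCores]
  · -- (Z2) integrality
    intro U hU
    exact isogenyLayerMapK_mem_integralH1K p α U (h2 U ((hlay U).mp hU))
  · -- (Z3a) equivariance of `𝔏′` on the normal layers of `E′`
    intro n σ x
    simp only [LinearMap.coe_comp, Function.comp_apply, LinearMap.smul_apply, map_smul]
    rw [isogenyLayerMapK_conjMap, h3a' (torsionLayer E' (p ^ n * f)) n (htor n) σ, map_id_smul]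
  · -- (Z3b) `𝔏′` is local at `p`
    intro U hU x hx
    simp only [LinearMap.coe_comp, Function.comp_apply, LinearMap.smul_apply]
    exact h3b U ((hlay U).mp hU) _ ((isLocallyTrivialAt_isogenyLayerMapK p β U hx).smul _)
  · -- (Z4) rationality: the declared coordinate
    intro U hU
    obtain ⟨hfix, hval⟩ := h4 U ((hlay U).mp hU)
    refine ⟨hfix, ?_⟩
    simp only [LinearMap.coe_comp, Function.comp_apply, LinearMap.smul_apply]
    rw [isogenyLayerMapK_isogenyLayerMapK_of_comp_eq_zsmul p α β hβα, ← Int.cast_smul_eq_zsmul ℤ_[p] d, smul_smul,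
      ← hu, Units.inv_mul, one_smul, hval]
  · -- (Z5) the value law (unchanged)
    intro U hU χ hχ L hL
    exact h5 U ((hlay U).mp hU) χ hχ L hL

/-- **One datum at `E′` from one datum at `E`** (the quantifier shape of `CM.prop159_ellipticUnits_expStar_values`):
given isogenies `α : E → E′`, `β : E′ → E` with `β ∘ α = [d]`, `gcd(d, p·f) = 1`, and at `E` a period `Ω` and ONE datum `𝔏`
such that every ideal `𝔞` prime to `6pf` has classes and values `(w, y)` with `EllipticZetaBody K E p ψ f ι Ω 𝔏 𝔞 w y`, there
is ONE datum `𝔏′` at `E′` with the same property for the SAME `Ω` (and the same values `y`, classes `α_* w`).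
[cite: Kato2004Asterisque, Prop. 15.9 and (15.9.1) (pp. 258–259), §8.1 (8.1.3) (p. 180)] [cite: SilvermanAEC2009, Thm. III.6.1 (a)] -/
theorem exists_ellipticZetaBody_of_isogeny (α : WeierstrassCurve.Isogeny E E') (β : WeierstrassCurve.Isogeny E' E)
    {d : ℤ} (hβα : ∀ P, β (α P) = d • P) {f : ℕ} (hdf : IsCoprime d ((p * f : ℕ) : ℤ))
    (ψ : HeckeCharacter K) (ι : AlgebraicClosure K →+* ℂ) (Ω : ℂ)
    (𝔏 : ∀ U : Subgroup (absoluteGaloisGroup K), H1 (tateRepK E p) U →ₗ[ℤ_[p]] ℚ_[p] ⊗[ℤ] AlgebraicClosure K)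
    (S : Set (Ideal (𝓞 K)))
    (h : ∀ 𝔞 ∈ S, ∃ (w : ∀ U : Subgroup (absoluteGaloisGroup K), H1 (tateRepK E p) U)
        (y : Subgroup (absoluteGaloisGroup K) → AlgebraicClosure K), EllipticZetaBody K E p ψ f ι Ω 𝔏 𝔞 w y) :
    ∃ 𝔏' : ∀ U : Subgroup (absoluteGaloisGroup K), H1 (tateRepK E' p) U →ₗ[ℤ_[p]] ℚ_[p] ⊗[ℤ] AlgebraicClosure K,
      ∀ 𝔞 ∈ S, ∃ (w' : ∀ U : Subgroup (absoluteGaloisGroup K), H1 (tateRepK E' p) U)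
        (y : Subgroup (absoluteGaloisGroup K) → AlgebraicClosure K), EllipticZetaBody K E' p ψ f ι Ω 𝔏' 𝔞 w' y := by
  obtain ⟨u, hu⟩ := isUnit_intCast_padicInt_of_isCoprime p hdf
  refine ⟨fun U ↦ 𝔏 U ∘ₗ (((u⁻¹ : ℤ_[p]ˣ) : ℤ_[p]) • isogenyLayerMapK p β U), fun 𝔞 h𝔞 ↦ ?_⟩
  obtain ⟨w, y, hw⟩ := h 𝔞 h𝔞
  exact ⟨_, y, EllipticZetaBody.isogeny_transport p α β hβα u hu hdf hw⟩

end Transport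

end Literature.NumberTheory.EllipticCurves.Kato2004.CM

end
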